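import Literature.MathematicalPhysics.QuantumFieldTheory.Balaban1983to89.B8Thm2TorusSupplier
import Literature.MathematicalPhysics.QuantumFieldTheory.Balaban1983to89.B8Prop5KLevelLetters
import Literature.MathematicalPhysics.QuantumFieldTheory.Balaban1983to89.B8TorusShiftLandau
import Literature.MathematicalPhysics.QuantumFieldTheory.Balaban1983to89.B8TorusShiftAveraging
import Literature.MathematicalPhysics.QuantumFieldTheory.Balaban1983to89.B7TranslationCovariance

/-!
# `Balaban1983to89.B8Thm2TorusServerP` — [Balaban1985RegularSpaces] Prop. 5 (p. 94) on the torus `T_η`, §1 of route P's SERVER: the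
# Proposition-5 STEP SOCKET of `B8Thm2TorusSupplier` from the ∃λ-body of Proposition 5's fixed point WITH `τ(λ) = 0` (joint J-SU), a group law
# «`e^{iλ} ∈ G` for Hermitian `τ`-free `λ`» and PERIODICITY BY UNIQUENESS (sub-row «G-B8-T2S», route P, layer L4 §1)

statement-level skeleton of published theorems with citation tags; proofs where landed; nothing here is a claim about the
Yang–Mills mass gap

T. Bałaban, *Spaces of regular gauge field configurations on a lattice and gauge fixing conditions*, Commun. Math. Phys. **99** (1985)
75–102 `[Balaban1985RegularSpaces]` ("B8"): Proposition 5 (1.106)–(1.109) p. 94 («there exists exactly one function λ»), Theorem 4 p. 88, p. 77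
(«Ω_j = T_η»), p. 76 (`G = SU(N)`).  STATUS: published, refereed.

CITATION HEADER (lean-in-tree rule).  Cell `lit-balaban`, seat `lit-balaban-t2s-1` (gen 0), sub-row «G-B8-T2S» (R3 `stmt-QuantumFields-19200`),
route P of RULING #2 (composition of record), layer L4 §1 of `lit-balaban-t2s-1/J-SU-ROADMAP.md`.  WHAT IS REPRODUCED.  `B8Thm2TorusSupplier.SockP5Step`
asks, for a `G`-valued `P`-periodic level-`m` datum `(u₁, U₁, A)` of Theorem 4's induction on the torus, a `G`-VALUED `P`-PERIODIC `v = e^{iλ}` with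
(1.108), the Landau condition of `U₁^{v⁻¹}` at `m + 1` levels and (1.29) for `u₁v` at `m + 1` levels.  `B8SockHFPTraceFree.sockHFP_body_of_join_RD_traceFree`
delivers (at `Ω_j = T_η`, `Λ_j = torusLam`) a Hermitian `τ`-free `λ` with (1.108), the MULTIPLIER form of the Landau equation and (1.29).  THIS FILE is the
logical adapter between the two:
* `isLandau138W_torusLam_shiftCfg` — the Landau condition of record at a torus member is translation covariant (fine shifts `L^{m+1}w`;
  `B8TorusShiftLandau.isLandau138_torusLam_shiftCfg` + `logCfg_shiftCfg`);
* ★ `sockP5Step_body_of_traceFree` — for ONE datum: ∃λ-body with `τ(λ) = 0` + «`e^{iλ(x)} ∈ G` for Hermitian `τ`-free `λ`» (`hG3`; `SU(N)`: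
  `B8SpecialUnitaryTrace.gaugeExp_mem_specialUnitaryUnits`) + print's «exactly one» at level `m + 1` (a uniqueness clause `huniq` in the shape of the knit's
  `SockP5uE`, served by route K's socket) + `P ∈ L^{m+1}ℤ` and `P`-periodic `U₀, U₁, u₁` ⟹ the ∃-conclusion of `SockP5Step … G U₀ U′ m` for this datum:
  `v := e^{iλ}` (multiplier form ⇒ Landau condition by `B8Eq138LandauZd.isLandau138W_gaugeFixed_of_multiplier`, as in `B8Prop5KLevelLetters.hP5_step_of_HFP`);
  `v` is `G`-valued by `hG3`; `v` is `P`-periodic because its translate by `P e_i` solves the same problem (covariance of every clause for periodic data)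
  and Proposition 5's solution is unique.
NOT CLAIMED here: the instantiation of the body at the torus members from `LettersAt`/`LettersTau` (§2), the other sockets (§3), `Thm2TorusAt` at `G`.

HONEST SCOPE.  Bookkeeping; no new analysis.  Count-neutral; N05 ∕ `stub_PV3A` NOT discharged; nothing continuum ∕ ℝ⁴ ∕ OS ∕ mass-gap ∕ Clay.  No
`sorry`, no `def`, no `… : Prop` fact, no `instance`, no `notation`.
-/

noncomputable section

open NormedSpace
open scoped BigOperators

namespace Literature.MathematicalPhysics.QuantumFieldTheory.Balaban1983to89.B8Thm2TorusServerP

open Complex (I)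
open MatrixLog B7Prop1Explicit B7Prop2Explicit B7Prop1Local B7Eq92Concrete
open B7Eq78Linearization (conjR)
open B8Ineq132 (covDerivFwd covDeriv BondTouches)
open B8Eq140Level (SideTouches)
open B8Eq119TwistedAxial (Restr129)
open B8Eq184Proof (gaugeExp cfgExp)
open B8Eq138LandauZd (IsLandau138 IsLandau138W covLap covDivB QT logCfg isLandau138W_congr)
open B8Prop5KLevelLetters (isLandau138W_gaugeFixed_of_multiplier)
open B8Eq182Proof (gAd)
open B8Eq188Proof (frakF3)
open B12Ineq417Flat (shiftCfg shiftCfg_apply)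
open B8Thm4TorusAt (torusLam mem_torusLam_iff)
open B8Thm2TorusSupplier (SockP5Step sideTouches_univ)
open B8TorusShiftLandau (isLandau138_torusLam_shiftCfg)
open B8TorusShiftAveraging (restr129_torusLam_shiftCfg)
open B8TorusShiftStencils (covDerivFwd_shiftCfg logCfg_shiftCfg)
open B7TranslationCovariance (mgauge_shiftCfg)

-- `Site` alone could resolve to the torus sites of `Setup.lean`; re-export the `ℤ^d` sites of `B7Prop1Explicit`.
export B7Prop1Explicit (Site)

variable {d : ℕ}

section Adapter

variable {𝔸 : Type*} [CStarAlgebra 𝔸] [Nontrivial 𝔸]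

omit [Nontrivial 𝔸] in
/-- **The Landau condition of record at a torus member is translation covariant** (fine shifts by `Lᵐw`): `IsLandau138W = IsLandau138 ∘ logCfg`,
`logCfg` commutes with translations, and `B8TorusShiftLandau.isLandau138_torusLam_shiftCfg`. [cite: Balaban1985RegularSpaces, (1.38) p.82, p.77 («Ω_j = T_η»)] -/
theorem isLandau138W_torusLam_shiftCfg {L : ℕ} (hL : 1 ≤ L) (m : ℕ) (η : ℝ) (U₀ W : Site d → Fin d → 𝔸ˣ) (w : Site d)
    (h : IsLandau138W L m η (Set.univ : Set (Site d)) (torusLam m) U₀ W) :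
    IsLandau138W L m η (Set.univ : Set (Site d)) (torusLam m) (shiftCfg (((L : ℤ) ^ m) • w) U₀) (shiftCfg (((L : ℤ) ^ m) • w) W) := by
  unfold IsLandau138W at h ⊢
  rw [logCfg_shiftCfg]
  exact isLandau138_torusLam_shiftCfg hL m η U₀ _ w h

omit [Nontrivial 𝔸] in
/-- A `P`-periodic configuration is fixed by the translation `t_{P e_i}`. [cite: Balaban1985RegularSpaces, p.77 («Ω_j = T_η»)] -/
theorem shiftCfg_eq_of_periodic {β : Type*} {P : ℤ} {F : Site d → β} (hF : ∀ (x : Site d) (i : Fin d), F (x + P • e i) = F x) (i : Fin d) :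
    shiftCfg (P • e i) F = F := funext fun x => by rw [shiftCfg_apply, hF x i]

/-- ★ **THE PROPOSITION-5 STEP SOCKET OF ROUTE P FROM THE `τ`-FREE ∃λ-BODY, FOR ONE DATUM** (p. 94; joint J-SU + periodicity by «exactly one»).
DATA: a torus member (`L`, level `m + 1`, spacing `η`), a period `P ∈ L^{m+1}ℤ`, a `P`-periodic unitary background `U₀`, a `P`-periodic level-`m`
datum `(u₁, U₁ = e^{iηA})` with `|A| ≤ c⋆(Lᵐη)⁻¹`, `A` Hermitian.  HYPOTHESES: the ∃λ-body of Proposition 5's fixed point at `m + 1` levels on `T_η`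
WITH `τ(λ) = 0` (`hbody`, the conclusion of `B8SockHFPTraceFree.sockHFP_body_of_join_RD_traceFree` at `Ω_j = T_η`, `Λ_j = torusLam`); the group
law `hG3` («`e^{iλ(x)} ∈ G` for Hermitian `τ`-free `λ`»); print's «exactly one» at `m + 1` levels in the knit's shape (`huniq`, radius `cu > α₄`);
windows `α₄ ≤ 1/84`, `c⋆ ≤ 1/12`.  CONCLUSION: the ∃-clause of `B8Thm2TorusSupplier.SockP5Step … G U₀ U′ m` for this datum — a `G`-valued
`P`-periodic `v = e^{iλ}` with (1.108) at `α₄`, `U₁^{v⁻¹}` Landau at `m + 1` levels, (1.29) for `u₁v` at `m + 1` levels.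
[cite: Balaban1985RegularSpaces, Prop. 5 (1.106)–(1.109) p.94 («there exists exactly one function λ»), Thm 4 p.88, p.77, p.76] -/
theorem sockP5Step_body_of_traceFree (hd2 : 2 ≤ d) {η : ℝ} (hη : 0 < η) {L : ℕ} (hL : 1 ≤ L) (m : ℕ) {P : ℤ} (hP : ∃ c : ℤ, P = (L : ℤ) ^ (m + 1) * c)
    (τ : 𝔸 →L[ℂ] ℂ) {G : Subgroup 𝔸ˣ} (hG3 : ∀ (lam : Site d → 𝔸) (x : Site d), IsSelfAdjoint (lam x) → τ (lam x) = 0 → gaugeExp lam x ∈ G)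
    {U₀ U₁ : Site d → Fin d → 𝔸ˣ} (hU₀ : ∀ x κ, U₀ x κ ∈ unitaryUnits 𝔸) (hU₀P : ∀ (x : Site d) (i : Fin d), U₀ (x + P • e i) = U₀ x)
    (hU₁P : ∀ (x : Site d) (i : Fin d), U₁ (x + P • e i) = U₁ x)
    {u₁ : Site d → 𝔸ˣ} (hu₁P : ∀ (x : Site d) (i : Fin d), u₁ (x + P • e i) = u₁ x)
    {A : Site d → Fin d → 𝔸} {cstar α₄ cu : ℝ} (hs₁ : α₄ ≤ 1 / 84) (hcs : cstar ≤ 1 / 12) (hcu : α₄ < cu)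
    (hdat : ∀ (x : Site d) (κ : Fin d), U₁ x κ = cfgExp η A x κ ∧ IsSelfAdjoint (A x κ) ∧ ‖A x κ‖ ≤ cstar * ((L : ℝ) ^ m * η)⁻¹)
    (hbody : ∃ lam : Site d → 𝔸, (∀ x, IsSelfAdjoint (lam x)) ∧ (∀ x, x ∉ (Set.univ : Set (Site d)) → lam x = 0) ∧ (∀ x, τ (lam x) = 0) ∧
      (∀ j, j ≤ m + 1 → ∀ b ∈ {b : Site d × Fin d | SideTouches (Set.univ : Set (Site d)) b.1 b.2},
        ‖lam b.1‖ ≤ α₄ ∧ ((L : ℝ) ^ j * η) * ‖covDerivFwd η U₀ b.2 lam b.1‖ ≤ α₄) ∧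
      (∃ μ : ℕ → Site d → 𝔸, ∀ x ∈ (Set.univ : Set (Site d)),
        covLap η U₀ ((Set.univ : Set (Site d)).indicator fun y => covDivB η U₀ A y + covLap η U₀ lam y +
          ((conjR (gaugeExp lam y)⁻¹ (covDivB η U₀ A y) - covDivB η U₀ A y) +
            (gAd (covLap η U₀ lam y) (lam y) - covLap η U₀ lam y) + ∑ μ, frakF3 η U₀ lam A y μ)) x =
          QT L (m + 1) (torusLam (m + 1)) U₀ μ x) ∧
      Restr129 L (m + 1) (torusLam (m + 1)) U₀ (u₁ * gaugeExp lam))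
    (huniq : ∀ (v w : Site d → 𝔸ˣ) (lam mu : Site d → 𝔸),
      (∀ x, ((gaugeExp lam x : 𝔸ˣ) : 𝔸) = ((v x : 𝔸ˣ) : 𝔸) ∧ IsSelfAdjoint (lam x) ∧ ‖lam x‖ < cu) →
      (∀ (x : Site d) (κ : Fin d), ((L : ℝ) ^ (m + 1) * η) * ‖covDerivFwd η U₀ κ lam x‖ < cu) →
      (∀ x, ((gaugeExp mu x : 𝔸ˣ) : 𝔸) = ((w x : 𝔸ˣ) : 𝔸) ∧ IsSelfAdjoint (mu x) ∧ ‖mu x‖ < cu) →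
      (∀ (x : Site d) (κ : Fin d), ((L : ℝ) ^ (m + 1) * η) * ‖covDerivFwd η U₀ κ mu x‖ < cu) →
      IsLandau138W L (m + 1) η (Set.univ : Set (Site d)) (torusLam (m + 1)) U₀ (mgauge U₀ v⁻¹ U₁) →
      Restr129 L (m + 1) (torusLam (m + 1)) U₀ (u₁ * v) →
      IsLandau138W L (m + 1) η (Set.univ : Set (Site d)) (torusLam (m + 1)) U₀ (mgauge U₀ w⁻¹ U₁) →
      Restr129 L (m + 1) (torusLam (m + 1)) U₀ (u₁ * w) → ∀ x, v x = w x) :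
    ∃ (v : Site d → 𝔸ˣ) (lam : Site d → 𝔸), (∀ x, v x ∈ G) ∧ (∀ (x : Site d) (i : Fin d), v (x + P • e i) = v x) ∧
      (∀ x, ((v x : 𝔸ˣ) : 𝔸) = ((gaugeExp lam x : 𝔸ˣ) : 𝔸)) ∧ (∀ x, ‖lam x‖ ≤ α₄) ∧
      (∀ (x : Site d) (κ : Fin d), ((L : ℝ) ^ (m + 1) * η) * ‖covDerivFwd η U₀ κ lam x‖ ≤ α₄) ∧
      IsLandau138W L (m + 1) η (Set.univ : Set (Site d)) (torusLam (m + 1)) U₀ (mgauge U₀ v⁻¹ U₁) ∧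
      Restr129 L (m + 1) (torusLam (m + 1)) U₀ (u₁ * v) := by
  obtain ⟨lam, hsa, -, hτ0, h108, hmult, h129⟩ := hbody
  have hST : ∀ (y : Site d) (κ : Fin d), (y, κ) ∈ {b : Site d × Fin d | SideTouches (Set.univ : Set (Site d)) b.1 b.2} :=
    fun y κ => sideTouches_univ hd2 y κ
  have hα12 : α₄ ≤ 1 / 12 := hs₁.trans (by norm_num)
  have hα70 : α₄ ≤ 1 / 70 := hs₁.trans (by norm_num)
  have hd1 : 0 < d := by omega
  have hLr : (1 : ℝ) ≤ L := by exact_mod_cast hL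
  -- (1.108) at level `0` and at level `m + 1`, everywhere (every bond touches `T_η`)
  have h0 : ∀ (y : Site d) (κ : Fin d), ‖lam y‖ ≤ α₄ ∧ η * ‖covDerivFwd η U₀ κ lam y‖ ≤ α₄ := fun y κ => by
    simpa only [pow_zero, one_mul] using h108 0 (Nat.zero_le _) (y, κ) (hST y κ)
  have htop : ∀ (y : Site d) (κ : Fin d), ((L : ℝ) ^ (m + 1) * η) * ‖covDerivFwd η U₀ κ lam y‖ ≤ α₄ := fun y κ =>
    (h108 (m + 1) le_rfl (y, κ) (hST y κ)).2
  -- the Landau condition of `e^{iηA}` gauge-fixed by `e^{−iλ}` from the multiplier form (`isLandau138W_gaugeFixed_of_multiplier`)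
  have hl : ∀ x ∈ (Set.univ : Set (Site d)), ‖lam x‖ ≤ 1 / 12 := fun x _ => (h0 x ⟨0, hd1⟩).1.trans hα12
  have hD : ∀ x ∈ (Set.univ : Set (Site d)), ∀ μ, η * ‖covDerivFwd η U₀ μ lam x‖ ≤ 1 / 70 := fun x _ μ => (h0 x μ).2.trans hα70
  have ha : ∀ x ∈ (Set.univ : Set (Site d)), ∀ μ, η * ‖covDeriv η U₀ μ lam x‖ ≤ 1 / 70 := fun x _ μ => by
    rw [B8Eq151V2Divergence.norm_covDeriv_eq (unitaryUnits_le_U1 (hU₀ _ _)) lam]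
    exact (h0 _ μ).2.trans hα70
  have hY : ∀ x ∈ (Set.univ : Set (Site d)), ∀ μ, η * ‖conjR (U₀ (x - e μ) μ)⁻¹ (A (x - e μ) μ)‖ ≤ 1 / 12 := fun x _ μ => by
    obtain ⟨-, -, hA⟩ := hdat (x - e μ) μ
    rw [B8Ineq132.norm_conjR ((U1 𝔸).inv_mem (unitaryUnits_le_U1 (hU₀ _ _)))]
    have hLm : (1 : ℝ) ≤ (L : ℝ) ^ m := one_le_pow₀ hLr
    have hcs0 : 0 ≤ cstar := by
      have h := (norm_nonneg _).trans hA
      have hpos : (0 : ℝ) < ((L : ℝ) ^ m * η)⁻¹ := by positivity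
      nlinarith
    have hA' : ‖A (x - e μ) μ‖ ≤ cstar * η⁻¹ := by
      refine hA.trans (mul_le_mul_of_nonneg_left ?_ hcs0)
      rw [mul_inv]
      calc ((L : ℝ) ^ m)⁻¹ * η⁻¹ ≤ 1 * η⁻¹ := mul_le_mul_of_nonneg_right (inv_le_one_of_one_le₀ hLm) (by positivity)
        _ = η⁻¹ := one_mul _
    calc η * ‖A (x - e μ) μ‖ ≤ η * (cstar * η⁻¹) := mul_le_mul_of_nonneg_left hA' hη.le
      _ = cstar := by rw [mul_left_comm, mul_inv_cancel₀ hη.ne', mul_one]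
      _ ≤ 1 / 12 := hcs
  have hLanA : IsLandau138W L (m + 1) η (Set.univ : Set (Site d)) (torusLam (m + 1)) U₀ (mgauge U₀ (gaugeExp lam)⁻¹ (cfgExp η A)) :=
    isLandau138W_gaugeFixed_of_multiplier hη L (m + 1) (Set.univ : Set (Site d)) (torusLam (m + 1)) U₀ A hl hD ha hY hmult
  have hU₁A : U₁ = cfgExp η A := funext fun x => funext fun κ => (hdat x κ).1
  have hLan : IsLandau138W L (m + 1) η (Set.univ : Set (Site d)) (torusLam (m + 1)) U₀ (mgauge U₀ (gaugeExp lam)⁻¹ U₁) := by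
    rw [hU₁A]; exact hLanA
  -- the candidate `v := e^{iλ}` and its clauses in the shape of `huniq`
  set v : Site d → 𝔸ˣ := gaugeExp lam with hv
  have hcl : ∀ x, ((gaugeExp lam x : 𝔸ˣ) : 𝔸) = ((v x : 𝔸ˣ) : 𝔸) ∧ IsSelfAdjoint (lam x) ∧ ‖lam x‖ < cu :=
    fun x => ⟨rfl, hsa x, ((h0 x ⟨0, hd1⟩).1).trans_lt hcu⟩
  have hclD : ∀ (x : Site d) (κ : Fin d), ((L : ℝ) ^ (m + 1) * η) * ‖covDerivFwd η U₀ κ lam x‖ < cu := fun x κ => (htop x κ).trans_lt hcu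
  -- PERIODICITY: the translate by `P e_i = L^{m+1}(c e_i)` solves the same problem, hence equals `v` (print's «exactly one»)
  have hper : ∀ (x : Site d) (i : Fin d), v (x + P • e i) = v x := by
    intro x i
    obtain ⟨c, hc⟩ := hP
    set a : Site d := P • e i with ha_def
    have haw : a = ((L : ℤ) ^ (m + 1)) • (c • e i) := by rw [ha_def, hc, smul_smul]
    have hU₀a : shiftCfg a U₀ = U₀ := shiftCfg_eq_of_periodic hU₀P i
    have hU₁a : shiftCfg a U₁ = U₁ := shiftCfg_eq_of_periodic hU₁P i
    have hu₁a : shiftCfg a u₁ = u₁ := shiftCfg_eq_of_periodic hu₁P i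
    -- the translated pair
    have hgauge : ∀ y, gaugeExp (shiftCfg a lam) y = shiftCfg a v y := fun y => rfl
    have hcl' : ∀ y, ((gaugeExp (shiftCfg a lam) y : 𝔸ˣ) : 𝔸) = ((shiftCfg a v y : 𝔸ˣ) : 𝔸) ∧ IsSelfAdjoint (shiftCfg a lam y) ∧
        ‖shiftCfg a lam y‖ < cu := fun y => ⟨rfl, by rw [shiftCfg_apply]; exact hsa _, by rw [shiftCfg_apply]; exact (hcl _).2.2⟩
    have hclD' : ∀ (y : Site d) (κ : Fin d), ((L : ℝ) ^ (m + 1) * η) * ‖covDerivFwd η U₀ κ (shiftCfg a lam) y‖ < cu := fun y κ => by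
      have h := covDerivFwd_shiftCfg η a U₀ κ lam y
      rw [hU₀a] at h
      rw [h]
      exact hclD _ κ
    have hLan' : IsLandau138W L (m + 1) η (Set.univ : Set (Site d)) (torusLam (m + 1)) U₀ (mgauge U₀ (shiftCfg a v)⁻¹ U₁) := by
      have h := isLandau138W_torusLam_shiftCfg hL (m + 1) η U₀ (mgauge U₀ v⁻¹ U₁) (c • e i) hLan
      rw [← haw, ← mgauge_shiftCfg, hU₀a, hU₁a] at h
      have hinv : shiftCfg a v⁻¹ = (shiftCfg a v)⁻¹ := rfl
      rw [hinv] at h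
      exact h
    have h129' : Restr129 L (m + 1) (torusLam (m + 1)) U₀ (u₁ * shiftCfg a v) := by
      have h := restr129_torusLam_shiftCfg L (m + 1) U₀ (u₁ * v) (c • e i) h129
      rw [← haw, hU₀a] at h
      have hmul : shiftCfg a (u₁ * v) = u₁ * shiftCfg a v := by
        funext y; rw [shiftCfg_apply, Pi.mul_apply, Pi.mul_apply, shiftCfg_apply, ← shiftCfg_apply a u₁ y, hu₁a]
      rw [hmul] at h
      exact h
    have heq := huniq v (shiftCfg a v) lam (shiftCfg a lam) hcl hclD hcl' hclD' hLan h129 hLan' h129' x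
    rw [heq, shiftCfg_apply]
  refine ⟨v, lam, fun x => hG3 lam x (hsa x) (hτ0 x), hper, fun x => rfl, fun x => (h0 x ⟨0, hd1⟩).1, htop, hLan, h129⟩

/-- ★ **THE PROPOSITION-5 BASE SOCKET OF ROUTE P FROM THE `τ`-FREE ∃λ-BODY** (p. 89 «for k = 0 … u₁ = 1, U₁ = U′»; p. 94): `sockP5Step_body_of_traceFree`
at `m = 0`, `u₁ = 1`, `U₁ = U′` — from the ∃λ-body of `B8SockHFPTraceFree.sockHFP₀_body_of_join_RD_traceFree` at `Ω_j = T_η`, `Λ_j = torusLam`, the group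
law `hG3`, print's «exactly one» at level `1` and `P ∈ Lℤ`: the ∃-clause of `B8Thm2TorusSupplier.SockP5Base … G U₀ U′` (a `G`-valued `P`-periodic
`v = e^{iλ}` with (1.108), `U′^{v⁻¹}` Landau at one level, (1.29) for `v` at one level).
[cite: Balaban1985RegularSpaces, Prop. 5 (1.106)–(1.109) p.94, p.89 (the start of the induction), p.77] -/
theorem sockP5Base_body_of_traceFree (hd2 : 2 ≤ d) {η : ℝ} (hη : 0 < η) {L : ℕ} (hL : 1 ≤ L) {P : ℤ} (hP : ∃ c : ℤ, P = (L : ℤ) * c)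
    (τ : 𝔸 →L[ℂ] ℂ) {G : Subgroup 𝔸ˣ} (hG3 : ∀ (lam : Site d → 𝔸) (x : Site d), IsSelfAdjoint (lam x) → τ (lam x) = 0 → gaugeExp lam x ∈ G)
    {U₀ U' : Site d → Fin d → 𝔸ˣ} (hU₀ : ∀ x κ, U₀ x κ ∈ unitaryUnits 𝔸) (hU₀P : ∀ (x : Site d) (i : Fin d), U₀ (x + P • e i) = U₀ x)
    (hU'P : ∀ (x : Site d) (i : Fin d), U' (x + P • e i) = U' x)
    {A : Site d → Fin d → 𝔸} {cstar α₄ cu : ℝ} (hs₁ : α₄ ≤ 1 / 84) (hcs : cstar ≤ 1 / 12) (hcu : α₄ < cu)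
    (hdat : ∀ (x : Site d) (κ : Fin d), U' x κ = cfgExp η A x κ ∧ IsSelfAdjoint (A x κ) ∧ ‖A x κ‖ ≤ cstar * ((L : ℝ) ^ 0 * η)⁻¹)
    (hbody : ∃ lam : Site d → 𝔸, (∀ x, IsSelfAdjoint (lam x)) ∧ (∀ x, x ∉ (Set.univ : Set (Site d)) → lam x = 0) ∧ (∀ x, τ (lam x) = 0) ∧
      (∀ j, j ≤ 1 → ∀ b ∈ {b : Site d × Fin d | SideTouches (Set.univ : Set (Site d)) b.1 b.2},
        ‖lam b.1‖ ≤ α₄ ∧ ((L : ℝ) ^ j * η) * ‖covDerivFwd η U₀ b.2 lam b.1‖ ≤ α₄) ∧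
      (∃ μ : ℕ → Site d → 𝔸, ∀ x ∈ (Set.univ : Set (Site d)),
        covLap η U₀ ((Set.univ : Set (Site d)).indicator fun y => covDivB η U₀ A y + covLap η U₀ lam y +
          ((conjR (gaugeExp lam y)⁻¹ (covDivB η U₀ A y) - covDivB η U₀ A y) +
            (gAd (covLap η U₀ lam y) (lam y) - covLap η U₀ lam y) + ∑ μ, frakF3 η U₀ lam A y μ)) x =
          QT L 1 (torusLam 1) U₀ μ x) ∧
      Restr129 L 1 (torusLam 1) U₀ ((1 : Site d → 𝔸ˣ) * gaugeExp lam))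
    (huniq : ∀ (v w : Site d → 𝔸ˣ) (lam mu : Site d → 𝔸),
      (∀ x, ((gaugeExp lam x : 𝔸ˣ) : 𝔸) = ((v x : 𝔸ˣ) : 𝔸) ∧ IsSelfAdjoint (lam x) ∧ ‖lam x‖ < cu) →
      (∀ (x : Site d) (κ : Fin d), ((L : ℝ) ^ 1 * η) * ‖covDerivFwd η U₀ κ lam x‖ < cu) →
      (∀ x, ((gaugeExp mu x : 𝔸ˣ) : 𝔸) = ((w x : 𝔸ˣ) : 𝔸) ∧ IsSelfAdjoint (mu x) ∧ ‖mu x‖ < cu) →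
      (∀ (x : Site d) (κ : Fin d), ((L : ℝ) ^ 1 * η) * ‖covDerivFwd η U₀ κ mu x‖ < cu) →
      IsLandau138W L 1 η (Set.univ : Set (Site d)) (torusLam 1) U₀ (mgauge U₀ v⁻¹ U') →
      Restr129 L 1 (torusLam 1) U₀ ((1 : Site d → 𝔸ˣ) * v) →
      IsLandau138W L 1 η (Set.univ : Set (Site d)) (torusLam 1) U₀ (mgauge U₀ w⁻¹ U') →
      Restr129 L 1 (torusLam 1) U₀ ((1 : Site d → 𝔸ˣ) * w) → ∀ x, v x = w x) :
    ∃ (v : Site d → 𝔸ˣ) (lam : Site d → 𝔸), (∀ x, v x ∈ G) ∧ (∀ (x : Site d) (i : Fin d), v (x + P • e i) = v x) ∧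
      (∀ x, ((v x : 𝔸ˣ) : 𝔸) = ((gaugeExp lam x : 𝔸ˣ) : 𝔸)) ∧ (∀ x, ‖lam x‖ ≤ α₄) ∧
      (∀ (x : Site d) (κ : Fin d), ((L : ℝ) ^ 1 * η) * ‖covDerivFwd η U₀ κ lam x‖ ≤ α₄) ∧
      IsLandau138W L 1 η (Set.univ : Set (Site d)) (torusLam 1) U₀ (mgauge U₀ v⁻¹ U') ∧ Restr129 L 1 (torusLam 1) U₀ v := by
  have hP' : ∃ c : ℤ, P = (L : ℤ) ^ (0 + 1) * c := by simpa only [zero_add, pow_one] using hP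
  have h1P : ∀ (x : Site d) (i : Fin d), (1 : Site d → 𝔸ˣ) (x + P • e i) = (1 : Site d → 𝔸ˣ) x := fun _ _ => rfl
  obtain ⟨v, lam, hG, hper, hv, hl, hD, hLan, h129⟩ := sockP5Step_body_of_traceFree hd2 hη hL 0 hP' τ hG3 hU₀ hU₀P hU'P (u₁ := 1) h1P hs₁ hcs
    hcu hdat hbody huniq
  refine ⟨v, lam, hG, hper, hv, hl, ?_, hLan, ?_⟩
  · simpa only [zero_add] using hD
  · simpa only [one_mul, zero_add] using h129

end Adapter

#print axioms sockP5Step_body_of_traceFree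
#print axioms sockP5Base_body_of_traceFree

end Literature.MathematicalPhysics.QuantumFieldTheory.Balaban1983to89.B8Thm2TorusServerP

end
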